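import Literature.NumberTheory.EllipticCurves.TunnellHalfIntegralFormsProofs
import Literature.NumberTheory.EllipticCurves.HalfIntegralWeightThetaMultiplier
import Literature.NumberTheory.EllipticCurves.JacobiThetaDerivativeFormula
import HarnessLib

/-!
# Tunnell's forms under the Fricke involution `z ↦ -1/(128 z)`

Exact transformation formulas, with principal branches, for Tunnell's theta series
(`thetaMul t = θ_t`, `tunnellG = g`, `tunnellForm t = g θ_t`, Tunnell 1983 §1) under the Fricke
involution `W z = -1/(128 z)` of level `128`, from Jacobi's inversion `θ(-1/τ) = (-iτ)^{1/2} θ(τ)`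
(Mathlib's `jacobiTheta_S_smul`) — write `r(z) = (-iz)^{1/2}`:

* `thetaMul_fricke` — **`θ_t(-1/(128z)) = √(2s) r(z) θ_s(z)`** for `t s = 32`
  (`θ_t(Wz) = θ(2t Wz)`-style: `2t · Wz = -1/(2sz)`);
* `tunnellG_fricke` — **`g(-1/(128z)) = 8√2 (-iz) g(z)`** (from `2g = (θ₁ - θ₄)(2θ₃₂ - θ₈)`,
  `TunnellHalfIntegralFormsProofs.two_mul_tunnellG_eq`): `g` is an eigenfunction of `W`;
* `tunnellForm_eight_fricke`, `tunnellForm_two_fricke`, `tunnellForm_thirtytwo_fricke` —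
  **`gθ₈(Wz) = 32 r³ gθ₄(z)`, `gθ₂(Wz) = 64 r³ gθ₁₆(z)`, `gθ₃₂(Wz) = 16 r³ gθ₁(z)`**, hence
  (`tunnellForm_two_sub_eight_fricke`, `two_mul_thirtytwo_sub_eight_fricke`)
  **`g(θ₂ - θ₈)(Wz) = 32 r³ (2gθ₁₆ - gθ₄)(z)`** and **`(2gθ₃₂ - gθ₈)(Wz) = 32 r³ (gθ₁ - gθ₄)(z)`**:
  `W` carries the three `T(p²)`-eigenlines of `S_{3/2}(128, 1)` (`gθ₈`, `g(θ₂ - θ₈)`,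
  `2gθ₃₂ - gθ₈`; `TunnellThmTwoTrivHeckeProofs`) to the lines of `gθ₄`, `gθ₄ - 2gθ₁₆`, `gθ₁ - gθ₄`
  in `S_{3/2}(128, χ₂)`.

## Why (the intended use; not proved here)

After `TunnellThmTwoOrdinaryProofs` (`heckeTSq_tunnellForm_eight`: `T(p²)(gθ₈) = a_p(E) gθ₈` for
all odd `p`), Tunnell's Theorem 2 (`Tunnell1983_thm2_triv/chi2`) needs only the eigenvalues of
`g(θ₂ - θ₈)` (trivial character) and of `gθ₁₆`, `gθ₄ - gθ₁₆` (character `χ₂`). If the Fricke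
involution `f ↦ r(z)⁻³ f(Wz)` is shown to map `S_{3/2}(128, χ)` to `S_{3/2}(128, χχ₂)` compatibly
with the operators `T(p²)` (Shimura 1973, §1: the involution attached to `(0, -1; N, 0)`
normalises `Γ₀(N)` and the double coset of `diag(1, p²)`), then by the formulas above `gθ₄` is a
`T(p²)`-eigenform with eigenvalue `a_p(E)`; since `gθ₄ = (gθ₄ - gθ₁₆) + gθ₁₆` is a sum of two
eigenforms (`heckeTSq_four_sub_sixteen_eigen`, `heckeTSq_tunnellForm_sixteen_eigen`, linearly
independent), both have eigenvalue `a_p(E)` — the `χ₂` case — and then `gθ₄ - 2gθ₁₆`, the image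
of `g(θ₂ - θ₈)`, has eigenvalue `a_p(E)` too, which is the missing trivial-character eigenvalue.
That compatibility is the one remaining structural input; this file supplies the explicit images.

## References

* J. B. Tunnell, *A classical Diophantine problem and modular forms of weight 3/2*, Invent. Math.
  72 (1983) 323–334, §1 (p. 326: `θ_t`; Thm 1: `g`; p. 327: the forms `g θ_t`).
  [Tunnell1983Congruent]
* G. Shimura, *On modular forms of half integral weight*, Ann. of Math. 97 (1973) 440–481, §1.
  [Shimura1973HalfIntegral]
-/

noncomputable section

open UpperHalfPlane hiding I
open Complex Real Literature.NumberTheory.EllipticCurves.ModularForms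

namespace Literature.NumberTheory.EllipticCurves.Tunnell1983

/-! ### The Fricke point and the factor `r(z) = (-iz)^{1/2}` -/

/-- `Im(-1/(128 z)) > 0`. [folklore] -/
theorem im_fricke_pos (z : ℍ) : 0 < (-1 / (128 * (z : ℂ))).im := by
  rw [neg_div, Complex.neg_im, one_div, Complex.inv_im, neg_div, neg_neg]
  refine div_pos (by simpa using mul_pos (by norm_num : (0:ℝ) < 128) z.im_pos) (Complex.normSq_pos.mpr ?_)
  exact mul_ne_zero (by norm_num) (UpperHalfPlane.ne_zero z)

/-- The Fricke involution of level `128` on `ℍ`: `W z = -1/(128 z)`. [folklore] -/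
def frickePt (z : ℍ) : ℍ := ⟨-1 / (128 * (z : ℂ)), im_fricke_pos z⟩

/-- `↑(W z) = -1/(128 z)`. [folklore] -/
@[simp] theorem coe_frickePt (z : ℍ) : ((frickePt z : ℍ) : ℂ) = -1 / (128 * (z : ℂ)) := rfl

/-- `r(z) = (-iz)^{1/2}` (principal branch). [folklore] -/
def frickeR (z : ℍ) : ℂ := (-I * (z : ℂ)) ^ (1 / 2 : ℂ)

/-- `r(z)² = -iz`. [folklore] -/
theorem frickeR_sq (z : ℍ) : frickeR z ^ 2 = -I * (z : ℂ) :=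
  JacobiThetaNull.cpow_half_sq (z : ℂ)

/-- `(a x)^{1/2} = √a · x^{1/2}` for real `a > 0`. [folklore] -/
theorem ofReal_mul_cpow_half {a : ℝ} (ha : 0 < a) {x : ℂ} (hx : x ≠ 0) :
    ((a : ℂ) * x) ^ (1 / 2 : ℂ) = (Real.sqrt a : ℂ) * x ^ (1 / 2 : ℂ) := by
  have ha' : (a : ℂ) ≠ 0 := ofReal_ne_zero.mpr ha.ne'
  rw [cpow_def_of_ne_zero (mul_ne_zero ha' hx), Complex.log_ofReal_mul ha hx, add_mul,
    Complex.exp_add, ← cpow_def_of_ne_zero hx]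
  congr 1
  rw [show (Real.log a : ℂ) * (1 / 2 : ℂ) = ((Real.log a * (1 / 2) : ℝ) : ℂ) by push_cast; ring,
    ← Complex.ofReal_exp, Real.sqrt_eq_rpow, Real.rpow_def_of_pos ha]

/-! ### Square roots of the constants -/

/-- `√(2·32) = 8`. [folklore] -/
theorem sqrt_two_mul_thirtytwo : Real.sqrt (2 * (32 : ℕ)) = 8 := by
  rw [show (2 * (32 : ℕ) : ℝ) = 8 ^ 2 by norm_num, Real.sqrt_sq (by norm_num)]

/-- `√(2·8) = 4`. [folklore] -/
theorem sqrt_two_mul_eight : Real.sqrt (2 * (8 : ℕ)) = 4 := by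
  rw [show (2 * (8 : ℕ) : ℝ) = 4 ^ 2 by norm_num, Real.sqrt_sq (by norm_num)]

/-- `√(2·2) = 2`. [folklore] -/
theorem sqrt_two_mul_two : Real.sqrt (2 * (2 : ℕ)) = 2 := by
  rw [show (2 * (2 : ℕ) : ℝ) = 2 ^ 2 by norm_num, Real.sqrt_sq (by norm_num)]

/-- `√(2·1) = √2`. [folklore] -/
theorem sqrt_two_mul_one : Real.sqrt (2 * (1 : ℕ)) = Real.sqrt 2 := by norm_num

/-- `√(2·4) = 2√2`. [folklore] -/
theorem sqrt_two_mul_four : Real.sqrt (2 * (4 : ℕ)) = 2 * Real.sqrt 2 := by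
  rw [show (2 * (4 : ℕ) : ℝ) = 2 ^ 2 * 2 by norm_num, Real.sqrt_mul (by norm_num), Real.sqrt_sq (by norm_num)]

/-- `√(2·16) = 4√2`. [folklore] -/
theorem sqrt_two_mul_sixteen : Real.sqrt (2 * (16 : ℕ)) = 4 * Real.sqrt 2 := by
  rw [show (2 * (16 : ℕ) : ℝ) = 4 ^ 2 * 2 by norm_num, Real.sqrt_mul (by norm_num), Real.sqrt_sq (by norm_num)]

/-! ### `θ_t` under `W` -/

/-- `θ_t(w) = jacobiTheta (2 t w)`. [folklore] -/
theorem thetaMul_eq_jacobiTheta {t : ℕ} (ht : 0 < t) (w : ℍ) :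
    thetaMul t w = jacobiTheta (2 * ((t : ℂ) * w)) := by
  rw [thetaMul_eq_shimuraTheta ht, shimuraTheta]

/-- **`θ_t(-1/(128z)) = √(2s) (-iz)^{1/2} θ_s(z)`** for `t s = 32` (Jacobi's inversion
`θ(-1/τ) = (-iτ)^{1/2} θ(τ)` at `τ = 2sz`, as `2t · (-1/(128z)) = -1/(2sz)`).
[cite: Tunnell1983Congruent, p. 326] -/
theorem thetaMul_fricke {t s : ℕ} (hts : t * s = 32) (z : ℍ) :
    thetaMul t (frickePt z) = (Real.sqrt (2 * s) : ℂ) * frickeR z * thetaMul s z := by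
  have ht : 0 < t := Nat.pos_of_ne_zero fun h ↦ by simp [h] at hts
  have hs : 0 < s := Nat.pos_of_ne_zero fun h ↦ by simp [h] at hts
  have hz0 : (z : ℂ) ≠ 0 := UpperHalfPlane.ne_zero z
  -- the point `τ = 2 s z`
  set τ : ℍ := ⟨((2 * s : ℕ) : ℂ) * z, mul_im_pos (by positivity) z⟩ with hτ
  have hτc : ((τ : ℍ) : ℂ) = 2 * ((s : ℂ) * z) := by
    show ((2 * s : ℕ) : ℂ) * z = 2 * ((s : ℂ) * z)
    push_cast; ring
  have hS : ((ModularGroup.S • τ : ℍ) : ℂ) = -1 / (2 * ((s : ℂ) * z)) := by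
    rw [UpperHalfPlane.modular_S_smul, UpperHalfPlane.coe_mk, hτc, inv_neg, neg_div, one_div]
  have hts' : (t : ℂ) * s = 32 := by exact_mod_cast hts
  have ht0 : (t : ℂ) ≠ 0 := by exact_mod_cast ht.ne'
  have hs0 : (s : ℂ) ≠ 0 := by exact_mod_cast hs.ne'
  have hpt : 2 * ((t : ℂ) * (frickePt z : ℂ)) = -1 / (2 * ((s : ℂ) * z)) := by
    rw [coe_frickePt, show (128 : ℂ) = 4 * ((t : ℂ) * s) by rw [hts']; norm_num]
    field_simp
    ring
  rw [thetaMul_eq_jacobiTheta ht, hpt, ← hS, jacobiTheta_S_smul τ, hτc, ← thetaMul_eq_jacobiTheta hs,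
    show -I * (2 * ((s : ℂ) * z)) = (((2 * s : ℕ) : ℝ) : ℂ) * (-I * z) by push_cast; ring,
    ofReal_mul_cpow_half (by positivity) (mul_ne_zero (neg_ne_zero.mpr I_ne_zero) hz0), frickeR]
  push_cast
  ring

/-! ### `g` and the forms `g θ_t` under `W` -/

/-- **`g(-1/(128z)) = 8√2 (-iz) g(z)`**: Tunnell's `g` is an eigenfunction of the Fricke involution
(from `2g = (θ₁ - θ₄)(2θ₃₂ - θ₈)` and `θ_t(Wz) = √(2s) r θ_s`).
[cite: Tunnell1983Congruent, Thm 1 (p. 326)] -/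
theorem tunnellG_fricke (z : ℍ) :
    tunnellG (frickePt z) = 8 * (Real.sqrt 2 : ℂ) * (-I * (z : ℂ)) * tunnellG z := by
  have h := two_mul_tunnellG_eq (frickePt z)
  rw [thetaMul_fricke (t := 1) (s := 32) rfl, thetaMul_fricke (t := 4) (s := 8) rfl,
    thetaMul_fricke (t := 32) (s := 1) rfl, thetaMul_fricke (t := 8) (s := 4) rfl,
    sqrt_two_mul_thirtytwo, sqrt_two_mul_eight, sqrt_two_mul_one, sqrt_two_mul_four] at h
  have h0 := two_mul_tunnellG_eq z
  have e := frickeR_sq z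
  push_cast at h
  linear_combination (1 / 2 : ℂ) * h - 4 * (Real.sqrt 2 : ℂ) * frickeR z ^ 2 * h0 +
    8 * (Real.sqrt 2 : ℂ) * tunnellG z * e

/-- **`gθ₈(-1/(128z)) = 32 (-iz)^{3/2} gθ₄(z)`** (`(-iz)^{3/2} = r³`). [cite: Tunnell1983Congruent, p. 327] -/
theorem tunnellForm_eight_fricke (z : ℍ) :
    tunnellForm 8 (frickePt z) = 32 * frickeR z ^ 3 * tunnellForm 4 z := by
  rw [tunnellForm, tunnellForm, tunnellG_fricke, thetaMul_fricke (t := 8) (s := 4) rfl, sqrt_two_mul_four]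
  have e := frickeR_sq z
  have e2 : ((Real.sqrt 2 : ℝ) : ℂ) ^ 2 = 2 := by exact_mod_cast Real.sq_sqrt (by norm_num : (0 : ℝ) ≤ 2)
  push_cast
  linear_combination 16 * frickeR z * tunnellG z * thetaMul 4 z * (-I * (z : ℂ)) * e2 -
    32 * frickeR z * tunnellG z * thetaMul 4 z * e

/-- **`gθ₂(-1/(128z)) = 64 (-iz)^{3/2} gθ₁₆(z)`.** [cite: Tunnell1983Congruent, p. 327] -/
theorem tunnellForm_two_fricke (z : ℍ) :
    tunnellForm 2 (frickePt z) = 64 * frickeR z ^ 3 * tunnellForm 16 z := by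
  rw [tunnellForm, tunnellForm, tunnellG_fricke, thetaMul_fricke (t := 2) (s := 16) rfl, sqrt_two_mul_sixteen]
  have e := frickeR_sq z
  have e2 : ((Real.sqrt 2 : ℝ) : ℂ) ^ 2 = 2 := by exact_mod_cast Real.sq_sqrt (by norm_num : (0 : ℝ) ≤ 2)
  push_cast
  linear_combination 32 * frickeR z * tunnellG z * thetaMul 16 z * (-I * (z : ℂ)) * e2 -
    64 * frickeR z * tunnellG z * thetaMul 16 z * e

/-- **`gθ₃₂(-1/(128z)) = 16 (-iz)^{3/2} gθ₁(z)`.** [cite: Tunnell1983Congruent, p. 327] -/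
theorem tunnellForm_thirtytwo_fricke (z : ℍ) :
    tunnellForm 32 (frickePt z) = 16 * frickeR z ^ 3 * tunnellForm 1 z := by
  rw [tunnellForm, tunnellForm, tunnellG_fricke, thetaMul_fricke (t := 32) (s := 1) rfl, sqrt_two_mul_one]
  have e := frickeR_sq z
  have e2 : ((Real.sqrt 2 : ℝ) : ℂ) ^ 2 = 2 := by exact_mod_cast Real.sq_sqrt (by norm_num : (0 : ℝ) ≤ 2)
  linear_combination 8 * frickeR z * tunnellG z * thetaMul 1 z * (-I * (z : ℂ)) * e2 -
    16 * frickeR z * tunnellG z * thetaMul 1 z * e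

/-- **`g(θ₂ - θ₈)(-1/(128z)) = 32 (-iz)^{3/2} (2 gθ₁₆ - gθ₄)(z)`**: the Fricke involution carries
the class-`3` eigenline of `S_{3/2}(128, 1)` to the line of `gθ₄ - 2gθ₁₆` in `S_{3/2}(128, χ₂)`.
[cite: Tunnell1983Congruent, Thm 2 and p. 327] -/
theorem tunnellForm_two_sub_eight_fricke (z : ℍ) :
    tunnellForm 2 (frickePt z) - tunnellForm 8 (frickePt z) =
      32 * frickeR z ^ 3 * (2 * tunnellForm 16 z - tunnellForm 4 z) := by
  rw [tunnellForm_two_fricke, tunnellForm_eight_fricke]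
  ring

/-- **`(2 gθ₃₂ - gθ₈)(-1/(128z)) = 32 (-iz)^{3/2} (gθ₁ - gθ₄)(z)`**: the theta-series eigenline
goes to the theta-series eigenline. [cite: Tunnell1983Congruent, p. 327] -/
theorem two_mul_thirtytwo_sub_eight_fricke (z : ℍ) :
    2 * tunnellForm 32 (frickePt z) - tunnellForm 8 (frickePt z) =
      32 * frickeR z ^ 3 * (tunnellForm 1 z - tunnellForm 4 z) := by
  rw [tunnellForm_thirtytwo_fricke, tunnellForm_eight_fricke]
  ring

/-- `W` is an involution: `W (W z) = z`. [folklore] -/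
theorem frickePt_frickePt (z : ℍ) : frickePt (frickePt z) = z := by
  apply UpperHalfPlane.ext
  rw [coe_frickePt, coe_frickePt]
  have := UpperHalfPlane.ne_zero z
  field_simp

end Literature.NumberTheory.EllipticCurves.Tunnell1983
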